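import Summits.HubbardSuperconductivity.HubbardSuperconductivity.Theorems.AnisotropyChordTransferFibre3FinXDSideZ

/-!
# Route `AnisotropyChord` / H0 rotor rung: FIN per-`L` SIDE-CONDITION cell facts, `L = 11` (GM₃ cells 182–191)

Kernel facts `sdCellAnyZ 11 (49/50) 20 la lb (c, bn, aD) = true` (regime clause `mHole ≥ 0 ∧ facMI·η·(aD + b/(2+cos θ)) < c` on the cell, or vacuity), g5's `xbEval` objects, `decide +kernel`.
Prover seat `hubbard-h0-rotor-p3` g7; helper for piece A = stmt-HubbardSuperconductivity-23918 of rung 19089 (`--supports`, helper class).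
WHAT THIS IS NOT: nothing here proves superconductivity in the Hubbard model (rotor TARGET as worded stays FALSE, g15 verdict); kernel facts /
assembly for ONE conditional reduction at one `L`.  No sorry.
-/

set_option linter.dupNamespace false
set_option autoImplicit false

namespace Summit.HubbardSuperconductivity.HubbardSuperconductivity.Theorems.AnisotropyChord.Transfer.Fibre3

namespace FinXD

/-- side-condition cell `[19811690721290669, 20049431009946157]` of `L = 11` (`cert`). [folklore] -/
theorem sd11_182 : sdCellAnyZ 11 (49/50 : ℚ) 20 19811690721290669 20049431009946157 ((9/20 : ℚ), (27 : ℕ), (1/20 : ℚ)) = true := by decide +kernel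

/-- side-condition cell `[20049431009946157, 20290024182065513]` of `L = 11` (`cert`). [folklore] -/
theorem sd11_183 : sdCellAnyZ 11 (49/50 : ℚ) 20 20049431009946157 20290024182065513 ((9/20 : ℚ), (27 : ℕ), (1/20 : ℚ)) = true := by decide +kernel

/-- side-condition cell `[20290024182065513, 20533504472250301]` of `L = 11` (`cert`). [folklore] -/
theorem sd11_184 : sdCellAnyZ 11 (49/50 : ℚ) 20 20290024182065513 20533504472250301 ((9/20 : ℚ), (28 : ℕ), (1/20 : ℚ)) = true := by decide +kernel

/-- side-condition cell `[20533504472250301, 20779906525917305]` of `L = 11` (`cert`). [folklore] -/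
theorem sd11_185 : sdCellAnyZ 11 (49/50 : ℚ) 20 20533504472250301 20779906525917305 ((9/20 : ℚ), (28 : ℕ), (1/20 : ℚ)) = true := by decide +kernel

/-- side-condition cell `[20779906525917305, 21029265404228313]` of `L = 11` (`cert`). [folklore] -/
theorem sd11_186 : sdCellAnyZ 11 (49/50 : ℚ) 20 20779906525917305 21029265404228313 ((9/20 : ℚ), (28 : ℕ), (1/20 : ℚ)) = true := by decide +kernel

/-- side-condition cell `[21029265404228313, 21281616589079053]` of `L = 11` (`cert`). [folklore] -/
theorem sd11_187 : sdCellAnyZ 11 (49/50 : ℚ) 20 21029265404228313 21281616589079053 ((9/20 : ℚ), (29 : ℕ), (1/20 : ℚ)) = true := by decide +kernel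

/-- side-condition cell `[21281616589079053, 21536995988148001]` of `L = 11` (`cert`). [folklore] -/
theorem sd11_188 : sdCellAnyZ 11 (49/50 : ℚ) 20 21281616589079053 21536995988148001 ((9/20 : ℚ), (29 : ℕ), (1/20 : ℚ)) = true := by decide +kernel

/-- side-condition cell `[21536995988148001, 21795439940005777]` of `L = 11` (`cert`). [folklore] -/
theorem sd11_189 : sdCellAnyZ 11 (49/50 : ℚ) 20 21536995988148001 21795439940005777 ((9/20 : ℚ), (29 : ℕ), (1/20 : ℚ)) = true := by decide +kernel

/-- side-condition cell `[21795439940005777, 32693159910008665]` of `L = 11` (`num`). [folklore] -/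
theorem sd11_190 : sdCellAnyZ 11 (49/50 : ℚ) 20 21795439940005777 32693159910008665 ((1 : ℚ), (1 : ℕ), (1 : ℚ)) = true := by decide +kernel

/-- side-condition cell `[32693159910008665, 36939039111308064]` of `L = 11` (`num`). [folklore] -/
theorem sd11_191 : sdCellAnyZ 11 (49/50 : ℚ) 20 32693159910008665 36939039111308064 ((1 : ℚ), (1 : ℕ), (1 : ℚ)) = true := by decide +kernel

end FinXD

end Summit.HubbardSuperconductivity.HubbardSuperconductivity.Theorems.AnisotropyChord.Transfer.Fibre3
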